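import Mathlib
import Summits.Ventures.PercRepro2.RootCutSupport

/-!
# The cut vertex separating the roots, I: the class and the glued state (blind cell PercRepro2,
p3 g2, 2026-08-25; `proofs/P3-BRIDGE.md` §10)

CLASS (`CutVertex`): an unmarked vertex `c` is a cut vertex of the graph separating the side
`VL ∋ a₁, o, b` from the side `VH ∋ a₂, a₃` (every edge lies within one side, the sides meet only in
`c`, no edge lies within both).  Every connection of the glued graph is read off the two side
restrictions (`conn_side` / `conn_cross` of `RootCutSupport.lean` with `c` as the common vertex):
the state `st` of ANY configuration is the glued state `gluedSt` of its `l`-state `lstC` (the five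
connections `a₁ ~ c, a₁ ~ o, a₁ ~ b, c ~ o, c ~ b` inside `VL`) and its `h`-state `hstC` (the
set partition of `{a₂, c, a₃}` inside `VH`) — `st_eq_glued`.  This is the state lemma of the
conditioning decomposition of S2.c (the typed count, and the cubic form, of the glued instance are
sums over the `h`-state triples of `l`-side forms with copy-wise mixed markings).  Own work;
standard axioms.
-/

namespace Summit.Ventures.PercRepro2

open UnionCluster

namespace CovForm

namespace RootBridge

open OneTyped

/-! ## The class -/

section Class

open Classical

variable {V : Type*} {E : Type*}
variable (ends : E → Sym2 V) (o a₁ a₂ a₃ b c : V)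

/-- **The cut vertex `c` separating the roots**: the graph splits into a side `VL ∋ a₁, o, b` and a
side `VH ∋ a₂, a₃` meeting only in the unmarked vertex `c`; every edge lies within one side, none
within both. -/
structure CutVertex (VL VH : Set V) : Prop where
  split : ∀ e, e ∈ within ends VL ∨ e ∈ within ends VH
  cap : ∀ t, t ∈ VL → t ∈ VH → t = c
  noloop : ∀ e, ¬ (e ∈ within ends VL ∧ e ∈ within ends VH)
  cL : c ∈ VL
  cH : c ∈ VH
  a1L : a₁ ∈ VL
  oL : o ∈ VL
  bL : b ∈ VL
  a2H : a₂ ∈ VH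
  a3H : a₃ ∈ VH
  a1c : a₁ ≠ c
  oc : o ≠ c
  bc : b ≠ c
  a2c : a₂ ≠ c
  a3c : a₃ ≠ c

/-- The `l`-state: `(a₁ ~ c, a₁ ~ o, a₁ ~ b, c ~ o, c ~ b)` inside the side `VL`. -/
abbrev LSt := Bool × Bool × Bool × Bool × Bool

namespace LSt
/-- `a₁ ~ c`. -/
def al (l : LSt) : Bool := l.1
/-- `o ∈ C(a₁)`. -/
def o1 (l : LSt) : Bool := l.2.1
/-- `b ∈ C(a₁)`. -/
def b1 (l : LSt) : Bool := l.2.2.1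
/-- `o ∈ C(c)`. -/
def oc (l : LSt) : Bool := l.2.2.2.1
/-- `b ∈ C(c)`. -/
def bc (l : LSt) : Bool := l.2.2.2.2
end LSt

/-- The `l`-state of a configuration. -/
noncomputable def lstC (VL : Set V) (x : Config E) : LSt :=
  (decide (Conn ends (withinRestr ends VL x) a₁ c), decide (Conn ends (withinRestr ends VL x) a₁ o),
    decide (Conn ends (withinRestr ends VL x) a₁ b), decide (Conn ends (withinRestr ends VL x) c o),
    decide (Conn ends (withinRestr ends VL x) c b))

/-- **The glued state**: the state `(q', Lo, Ho, Lb, Hb, L3, H3)` of the glued graph as a function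
of the `l`-state and the `h`-state: `q' = [a₁~c]_L [a₂~c]_H`, `L_o = [a₁~o]_L`, `H_o = [a₂~c]_H [c~o]_L`
(`b` alike), `L₃ = [a₁~c]_L [c~a₃]_H`, `H₃ = [a₂~a₃]_H`. -/
def gluedSt (l : LSt) (h : HState) : St :=
  (l.al && h.hv, l.o1, h.hv && l.oc, l.b1, h.hv && l.bc, l.al && h.v3, h.h3)

end Class

/-! ## The state lemma -/

section StateLemma

open Classical

variable {V : Type*} {E : Type*} [Fintype E] [DecidableEq E]
variable (ends : E → Sym2 V) (o a₁ a₂ a₃ b c : V)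

omit [Fintype E] [DecidableEq E] in
/-- **The state of any configuration of a cut-vertex instance is the glued state** of its two side
states (`c` in the role of the common vertex of `conn_side` / `conn_cross`). -/
theorem st_eq_glued {VL VH : Set V} (h : CutVertex ends o a₁ a₂ a₃ b c VL VH) (x : Config E) :
    st ends o a₁ a₂ a₃ b x =
      gluedSt (lstC ends o a₁ b c VL x) (hstC ends c a₂ a₃ VH x) := by
  have hsp : ∀ e, x e = true → e ∈ within ends VL ∨ e ∈ within ends VH := fun e _ => h.split e
  have hsp' : ∀ e, x e = true → e ∈ within ends VH ∨ e ∈ within ends VL := fun e he =>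
    (hsp e he).symm
  have hcap' : ∀ t, t ∈ VH → t ∈ VL → t = c := fun t h1 h2 => h.cap t h2 h1
  obtain ⟨hhv, hh3, hv3⟩ := hstC_coords ends c a₂ a₃ VH x
  unfold st gluedSt lstC
  simp only [LSt.al, LSt.o1, LSt.b1, LSt.oc, LSt.bc]
  rw [hhv, hh3, hv3]
  -- the seven coordinates
  have e1 : Conn ends x a₂ a₁ ↔
      Conn ends (withinRestr ends VH x) a₂ c ∧ Conn ends (withinRestr ends VL x) a₁ c := by
    rw [conn_cross ends hsp' hcap' ⟨h.cH, h.cL⟩ h.a2H h.a1L h.a1c]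
    exact and_congr_right fun _ => ⟨conn_symm, conn_symm⟩
  have e2 := conn_side ends hsp h.cap h.a1L h.oL
  have e3 : Conn ends x a₂ o ↔
      Conn ends (withinRestr ends VH x) a₂ c ∧ Conn ends (withinRestr ends VL x) c o :=
    conn_cross ends hsp' hcap' ⟨h.cH, h.cL⟩ h.a2H h.oL h.oc
  have e4 := conn_side ends hsp h.cap h.a1L h.bL
  have e5 : Conn ends x a₂ b ↔
      Conn ends (withinRestr ends VH x) a₂ c ∧ Conn ends (withinRestr ends VL x) c b :=
    conn_cross ends hsp' hcap' ⟨h.cH, h.cL⟩ h.a2H h.bL h.bc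
  have e6 : Conn ends x a₁ a₃ ↔
      Conn ends (withinRestr ends VL x) a₁ c ∧ Conn ends (withinRestr ends VH x) c a₃ :=
    conn_cross ends hsp h.cap ⟨h.cL, h.cH⟩ h.a1L h.a3H h.a3c
  have e7 := conn_side ends hsp' hcap' h.a2H h.a3H
  rw [decide_eq_decide.mpr e1, decide_eq_decide.mpr e2, decide_eq_decide.mpr e3,
    decide_eq_decide.mpr e4, decide_eq_decide.mpr e5, decide_eq_decide.mpr e6,
    decide_eq_decide.mpr e7]
  · simp only [Bool.decide_and, Bool.and_comm]
  all_goals infer_instance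

end StateLemma

end RootBridge

end CovForm

end Summit.Ventures.PercRepro2
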